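import Summits.NavierStokesRegularity.NavierStokesRegularity.Theorems.RungBlowupCofinal.Negative.SectoralWaveCasimir
import HarnessLib

/-!
# The generators are derivations of the convective product: azimuthal bookkeeping of the
# mean–wave system (`(V·∇)W`, `(W·∇)V` are `n`-fold waves, the mean Reynolds stress is zonal,
# the wave–wave fluctuation is a `2n`-fold wave)
# (route `AngularGalerkinLadder`, crux K1 `RungBlowupCofinal`; Negative lane, theorems only)

Negative-lane bookkeeping for `stmt-NavierStokesRegularity-19959` (K1 of route №8), cell ns-blowup,
refuter5 (K5-76), continuing `MeanWaveFoldRange` (K5-74) and `SectoralWaveCasimir` (K5-75) about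
the line `Cruxes/RungBlowupCofinal/Lines/qlwave.lean` (mean–wave rung profiles `U = V + W`, `V`
zonal, `W` an `n`-fold azimuthal wave with quadrature companion `W' = n⁻¹J₃W`). Nothing here
asserts a Theses declaration; no definition, no named fact. WHAT THIS IS NOT: not Navier–Stokes
evidence — pointwise differential identities for smooth vector fields on `ℝ³`, their convective
products `(u·∇)v` and the angular-momentum generators `J_a`; no rung dynamics, no profile is
constructed or excluded.

## Content

* §1 calculus of `convect u v = (u·∇)v` (smoothness, derivative, bilinearity in the forms used).
* **`angGen_convect` (Leibniz rule)** — for smooth `u, v` and every generator,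
  `J_a((u·∇)v) = ((J_a u)·∇)v + (u·∇)(J_a v)`: the derivative at the identity of the
  rotation-equivariance of the nonlinearity (finite form in the tree:
  `IsRungSolutionOn.conj_linearIsometryEquiv`); from `fderiv_angGen` and the symmetry of `D²v`.
* §3 — with `J₃V = 0` (the letter of `Qlwave.IsZonal V`) and `J₃(J₃W) = −νW`:
  `J₃((V·∇)W) = (V·∇)(J₃W)`, `J₃((W·∇)V) = ((J₃W)·∇)V`, `(V·∇)V` is zonal, and
  **`(V·∇)W`, `(W·∇)V` are again `ν`-waves** (`wave_convect_of_zonal_left/right`): the linear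
  terms of the line's WAVE equation keep the fold, as its docstring asserts.
* §4 — for an `n`-fold wave `W` (`J₃(J₃W) = −n²W`, `n ≠ 0`) and `W' = n⁻¹J₃W` (the letter of
  `Qlwave.waveConj n W`, kept as a hypothesis `hW'` so that `rfl` instantiates it): `J₃W' = −nW`,
  `nW' = J₃W`, `W'` is an `n`-fold wave; **`zonal_meanStress`**: `J₃(½((W·∇)W + (W'·∇)W')) = 0`
  — the letter of `Qlwave.meanStress n W` IS zonal; **`wave_waveFluctuation`**:
  `F = (W·∇)W − ½((W·∇)W + (W'·∇)W')` — the letter of `Qlwave.waveFluctuation n W` — satisfies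
  `J₃(J₃F) = −(2n)²F`, i.e. IS a `2n`-fold wave (via `J₃((W·∇)W − (W'·∇)W') = 2n((W'·∇)W + (W·∇)W')`
  and `J₃((W'·∇)W + (W·∇)W') = −2n((W·∇)W − (W'·∇)W')`).

Reading for the line: the `m`-bookkeeping written informally in `qlwave.lean` ("`⟨(W·∇)W⟩₀` has
`m = 0`", "the fluctuation is the `m = ±2n` part", "the cross terms `V–W` have `m = ±n`") is now
kernel-checked in the line's own pointwise typing. Consequently `stub_ql_closure`
(`L < 2n → IsBandLimited L W → IsAzimuthalWave n W → IsCobandLimited L (waveFluctuation n W)`)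
REDUCES EXACTLY to the operator-form fold statement "a smooth `2n`-fold wave is `L²`-orthogonal to
every compactly supported field band-limited of degree `L < 2n`" — of which K5-74 proves the
band-limited special case (`eq_zero_of_isBandLimited_of_azimuthalWave`); the general case needs the
azimuthal Fourier decomposition of band-limited fields (not in the tree) and is the stub's whole
remaining content. [cite: BullardGellman1954] (vector spherical harmonics and their azimuthal
index; here projection-free).
-/

noncomputable section

namespace Summit.NavierStokesRegularity.AngularGalerkinLadderAzimuthalLeibniz

open Set Function MeasureTheory
open scoped ContDiff RealInnerProductSpace
open Literature.Analysis.FluidPDE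
open Summit.NavierStokesRegularity.FluidComputer
open Summit.NavierStokesRegularity.FluidComputer.AngularLadder
open Summit.NavierStokesRegularity.AngularGalerkinLadderSectoralWave

variable {u v : EuclideanSpace ℝ (Fin 3) → EuclideanSpace ℝ (Fin 3)}

/-! ## §1 Calculus of the convective derivative -/

/-- The derivative field of a smooth map is smooth. [folklore] -/
theorem contDiff_fderiv_of_smooth {F : Type*} [NormedAddCommGroup F] [NormedSpace ℝ F]
    {f : EuclideanSpace ℝ (Fin 3) → F} (hf : ContDiff ℝ ∞ f) : ContDiff ℝ ∞ (fderiv ℝ f) :=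
  (contDiff_infty_iff_fderiv.1 hf).2

/-- `(u·∇)v` is smooth for smooth `u, v`. [folklore] -/
theorem contDiff_convect (hu : ContDiff ℝ ∞ u) (hv : ContDiff ℝ ∞ v) :
    ContDiff ℝ ∞ (convect u v) := by
  rw [show convect u v = fun y => fderiv ℝ v y (u y) from rfl]
  exact (contDiff_fderiv_of_smooth hv).clm_apply hu

/-- The derivative of `(u·∇)v`: `D((u·∇)v)(x) = Dv(x) ∘ Du(x) + D²v(x)(·)(u(x))`. [folklore] -/
theorem fderiv_convect (hu : ContDiff ℝ ∞ u) (hv : ContDiff ℝ ∞ v) (x : EuclideanSpace ℝ (Fin 3)) :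
    fderiv ℝ (convect u v) x =
      (fderiv ℝ v x).comp (fderiv ℝ u x) + (fderiv ℝ (fderiv ℝ v) x).flip (u x) := by
  rw [show convect u v = fun y => fderiv ℝ v y (u y) from rfl]
  exact fderiv_clm_apply ((contDiff_fderiv_of_smooth hv).differentiable (by simp) x)
    ((hu.differentiable (by simp)) x)

/-- `(u·∇)v` is additive in `u` (no hypotheses). [folklore] -/
theorem convect_add_left (u₁ u₂ v : EuclideanSpace ℝ (Fin 3) → EuclideanSpace ℝ (Fin 3))
    (x : EuclideanSpace ℝ (Fin 3)) :
    convect (fun y => u₁ y + u₂ y) v x = convect u₁ v x + convect u₂ v x := by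
  simp only [convect_apply, map_add]

/-- `(u·∇)v` is homogeneous in `u` (no hypotheses). [folklore] -/
theorem convect_smul_left (c : ℝ) (u v : EuclideanSpace ℝ (Fin 3) → EuclideanSpace ℝ (Fin 3))
    (x : EuclideanSpace ℝ (Fin 3)) :
    convect (fun y => c • u y) v x = c • convect u v x := by
  simp only [convect_apply, map_smul]

/-- `(u·∇)v` is homogeneous in `u`, subtraction form (no hypotheses). [folklore] -/
theorem convect_sub_left (u₁ u₂ v : EuclideanSpace ℝ (Fin 3) → EuclideanSpace ℝ (Fin 3))
    (x : EuclideanSpace ℝ (Fin 3)) :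
    convect (fun y => u₁ y - u₂ y) v x = convect u₁ v x - convect u₂ v x := by
  simp only [convect_apply, map_sub]

/-- `(u·∇)v` is additive in `v` (differentiable `v₁, v₂`). [folklore] -/
theorem convect_add_right (u : EuclideanSpace ℝ (Fin 3) → EuclideanSpace ℝ (Fin 3))
    {v₁ v₂ : EuclideanSpace ℝ (Fin 3) → EuclideanSpace ℝ (Fin 3)} (hv₁ : Differentiable ℝ v₁)
    (hv₂ : Differentiable ℝ v₂) (x : EuclideanSpace ℝ (Fin 3)) :
    convect u (fun y => v₁ y + v₂ y) x = convect u v₁ x + convect u v₂ x := by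
  have h : fderiv ℝ (fun y => v₁ y + v₂ y) x = fderiv ℝ v₁ x + fderiv ℝ v₂ x :=
    ((hv₁ x).hasFDerivAt.add (hv₂ x).hasFDerivAt).fderiv
  simp only [convect_apply]
  rw [h, add_apply]

/-- `(u·∇)v` is homogeneous in `v` (differentiable `v`). [folklore] -/
theorem convect_smul_right (u : EuclideanSpace ℝ (Fin 3) → EuclideanSpace ℝ (Fin 3))
    (hv : Differentiable ℝ v) (c : ℝ) (x : EuclideanSpace ℝ (Fin 3)) :
    convect u (fun y => c • v y) x = c • convect u v x := by
  have h : fderiv ℝ (fun y => c • v y) x = c • fderiv ℝ v x :=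
    ((hv x).hasFDerivAt.const_smul c).fderiv
  simp only [convect_apply]
  rw [h, smul_apply]

/-- `(u·∇)v` in `v`, subtraction form (differentiable `v₁, v₂`). [folklore] -/
theorem convect_sub_right (u : EuclideanSpace ℝ (Fin 3) → EuclideanSpace ℝ (Fin 3))
    {v₁ v₂ : EuclideanSpace ℝ (Fin 3) → EuclideanSpace ℝ (Fin 3)} (hv₁ : Differentiable ℝ v₁)
    (hv₂ : Differentiable ℝ v₂) (x : EuclideanSpace ℝ (Fin 3)) :
    convect u (fun y => v₁ y - v₂ y) x = convect u v₁ x - convect u v₂ x := by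
  have h : fderiv ℝ (fun y => v₁ y - v₂ y) x = fderiv ℝ v₁ x - fderiv ℝ v₂ x :=
    ((hv₁ x).hasFDerivAt.sub (hv₂ x).hasFDerivAt).fderiv
  simp only [convect_apply]
  rw [h, sub_apply]

/-! ## §2 The Leibniz rule: the generators are derivations of the convective product -/

/-- **Infinitesimal rotation-equivariance of the nonlinearity**: for smooth `u, v` and every
generator, `J_a((u·∇)v) = ((J_a u)·∇)v + (u·∇)(J_a v)` (the second derivatives cancel by the
symmetry of `D²v`). The finite form — `(u·∇)v` commutes with `u ↦ R u(R⁻¹·)` — is the tree's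
`IsRungSolutionOn.conj_linearIsometryEquiv`; this is its derivative at the identity. [folklore] -/
theorem angGen_convect (hu : ContDiff ℝ ∞ u) (hv : ContDiff ℝ ∞ v) (a : Fin 3)
    (x : EuclideanSpace ℝ (Fin 3)) :
    angGen a (convect u v) x = convect (angGen a u) v x + convect u (angGen a v) x := by
  rw [show angGen a (convect u v) x =
      crossCLM (axis a) (convect u v x) - fderiv ℝ (convect u v) x (crossCLM (axis a) x) from rfl,
    fderiv_convect hu hv x]
  simp only [convect_apply]
  rw [fderiv_angGen hv a x,
    show angGen a u x = crossCLM (axis a) (u x) - fderiv ℝ u x (crossCLM (axis a) x) from rfl]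
  simp only [sub_apply, add_apply, ContinuousLinearMap.comp_apply, ContinuousLinearMap.flip_apply,
    map_sub]
  rw [fderiv_fderiv_symm hv x (crossCLM (axis a) x) (u x)]
  abel

/-- Function form of `angGen_convect`. [folklore] -/
theorem angGen_convect_eq (hu : ContDiff ℝ ∞ u) (hv : ContDiff ℝ ∞ v) (a : Fin 3) :
    angGen a (convect u v) = fun x => convect (angGen a u) v x + convect u (angGen a v) x :=
  funext fun x => angGen_convect hu hv a x

/-! ## §3 Zonal fields and azimuthal waves under the convective product -/

section Azimuthal

variable {V W W' : EuclideanSpace ℝ (Fin 3) → EuclideanSpace ℝ (Fin 3)} {n : ℕ} {ν : ℝ}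

/-- A zonal left factor is transparent to `J₃`: `J₃((V·∇)W) = (V·∇)(J₃W)` when `J₃V = 0`.
[folklore] -/
theorem angGen_convect_of_zonal_left (hV : ContDiff ℝ ∞ V) (hW : ContDiff ℝ ∞ W)
    (hV0 : ∀ y, angGen 2 V y = 0) (x : EuclideanSpace ℝ (Fin 3)) :
    angGen 2 (convect V W) x = convect V (angGen 2 W) x := by
  rw [angGen_convect hV hW 2 x, convect_apply (angGen 2 V), hV0 x, map_zero, zero_add]

/-- A zonal right factor is transparent to `J₃`: `J₃((W·∇)V) = ((J₃W)·∇)V` when `J₃V = 0`.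
[folklore] -/
theorem angGen_convect_of_zonal_right (hW : ContDiff ℝ ∞ W) (hV : ContDiff ℝ ∞ V)
    (hV0 : ∀ y, angGen 2 V y = 0) (x : EuclideanSpace ℝ (Fin 3)) :
    angGen 2 (convect W V) x = convect (angGen 2 W) V x := by
  have h0 : angGen 2 V = fun _ => 0 := funext fun y => hV0 y
  rw [angGen_convect hW hV 2 x, convect_apply W (angGen 2 V), h0, fderiv_const_apply, zero_apply,
    add_zero]

/-- `(V·∇)V` is zonal for zonal `V`. [folklore] -/
theorem zonal_convect_self (hV : ContDiff ℝ ∞ V) (hV0 : ∀ y, angGen 2 V y = 0) :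
    ∀ y, angGen 2 (convect V V) y = 0 := by
  have h0 : angGen 2 V = fun _ => 0 := funext fun y => hV0 y
  intro y
  rw [angGen_convect_of_zonal_left hV hV hV0 y, convect_apply, h0, fderiv_const_apply, zero_apply]

/-- **`(V·∇)W` is an `n`-fold wave** for zonal `V` and an `n`-fold wave `W`
(`J₃(J₃W) = −νW ⇒ J₃(J₃((V·∇)W)) = −ν (V·∇)W`). [folklore] -/
theorem wave_convect_of_zonal_left (hV : ContDiff ℝ ∞ V) (hW : ContDiff ℝ ∞ W)
    (hV0 : ∀ y, angGen 2 V y = 0) (hwave : ∀ y, angGen 2 (angGen 2 W) y = -(ν • W y)) :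
    ∀ y, angGen 2 (angGen 2 (convect V W)) y = -(ν • convect V W y) := by
  have hJW : ContDiff ℝ ∞ (angGen 2 W) := contDiff_angGen hW 2
  have h1 : angGen 2 (convect V W) = convect V (angGen 2 W) :=
    funext fun x => angGen_convect_of_zonal_left hV hW hV0 x
  have h2 : angGen 2 (convect V (angGen 2 W)) = convect V (angGen 2 (angGen 2 W)) :=
    funext fun x => angGen_convect_of_zonal_left hV hJW hV0 x
  have h3 : angGen 2 (angGen 2 W) = fun y => (-ν) • W y := funext fun y => by rw [hwave y, neg_smul]
  intro y
  rw [h1, h2, h3, convect_smul_right V (hW.differentiable (by simp)) (-ν) y, neg_smul]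

/-- **`(W·∇)V` is an `n`-fold wave** for zonal `V` and an `n`-fold wave `W`. [folklore] -/
theorem wave_convect_of_zonal_right (hW : ContDiff ℝ ∞ W) (hV : ContDiff ℝ ∞ V)
    (hV0 : ∀ y, angGen 2 V y = 0) (hwave : ∀ y, angGen 2 (angGen 2 W) y = -(ν • W y)) :
    ∀ y, angGen 2 (angGen 2 (convect W V)) y = -(ν • convect W V y) := by
  have hJW : ContDiff ℝ ∞ (angGen 2 W) := contDiff_angGen hW 2
  have h1 : angGen 2 (convect W V) = convect (angGen 2 W) V :=
    funext fun x => angGen_convect_of_zonal_right hW hV hV0 x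
  have h2 : angGen 2 (convect (angGen 2 W) V) = convect (angGen 2 (angGen 2 W)) V :=
    funext fun x => angGen_convect_of_zonal_right hJW hV hV0 x
  have h3 : angGen 2 (angGen 2 W) = fun y => (-ν) • W y := funext fun y => by rw [hwave y, neg_smul]
  intro y
  rw [h1, h2, h3, convect_smul_left (-ν) W V y, neg_smul]

/-! ## §4 The wave's self-interaction: mean Reynolds stress (zonal) and fluctuation (`2n`-fold) -/

/-- The quadrature companion `W' = n⁻¹J₃W` (the letter of `Qlwave.waveConj n W`) is smooth.
[folklore] -/
theorem contDiff_conj (hW : ContDiff ℝ ∞ W) (hW' : W' = fun y => ((n : ℝ)⁻¹) • angGen 2 W y) :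
    ContDiff ℝ ∞ W' := by
  rw [hW']
  exact (contDiff_angGen hW 2).const_smul _

/-- `J₃W' = −nW` for an `n`-fold wave, `n ≠ 0`. [folklore] -/
theorem angGen_conj (hW : ContDiff ℝ ∞ W) (hn : n ≠ 0)
    (hwave : ∀ y, angGen 2 (angGen 2 W) y = -(((n : ℝ) ^ 2) • W y))
    (hW' : W' = fun y => ((n : ℝ)⁻¹) • angGen 2 W y) (y : EuclideanSpace ℝ (Fin 3)) :
    angGen 2 W' y = -((n : ℝ) • W y) := by
  have hJW : Differentiable ℝ (angGen 2 W) := (contDiff_angGen hW 2).differentiable (by simp)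
  have hn' : (n : ℝ) ≠ 0 := Nat.cast_ne_zero.2 hn
  rw [hW', show (fun y => ((n : ℝ)⁻¹) • angGen 2 W y) = ((n : ℝ)⁻¹) • angGen 2 W from rfl,
    angGen_smul hJW, Pi.smul_apply, hwave y, smul_neg, smul_smul, pow_two,
    inv_mul_cancel_left₀ hn']

/-- `nW' = J₃W`. [folklore] -/
theorem smul_conj (hn : n ≠ 0) (hW' : W' = fun y => ((n : ℝ)⁻¹) • angGen 2 W y)
    (y : EuclideanSpace ℝ (Fin 3)) : (n : ℝ) • W' y = angGen 2 W y := by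
  rw [hW']
  simp only
  rw [smul_smul, mul_inv_cancel₀ (Nat.cast_ne_zero.2 hn), one_smul]

/-- The companion of an `n`-fold wave is an `n`-fold wave. [folklore] -/
theorem wave_conj (hW : ContDiff ℝ ∞ W) (hn : n ≠ 0)
    (hwave : ∀ y, angGen 2 (angGen 2 W) y = -(((n : ℝ) ^ 2) • W y))
    (hW' : W' = fun y => ((n : ℝ)⁻¹) • angGen 2 W y) :
    ∀ y, angGen 2 (angGen 2 W') y = -(((n : ℝ) ^ 2) • W' y) := by
  have h1 : angGen 2 W' = (-(n : ℝ)) • W :=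
    funext fun y => by rw [angGen_conj hW hn hwave hW' y, Pi.smul_apply, neg_smul]
  intro y
  rw [h1, angGen_smul (hW.differentiable (by simp)), Pi.smul_apply, ← smul_conj hn hW' y, smul_smul,
    neg_mul, ← pow_two, neg_smul]

/-- **The mean Reynolds stress is zonal**: `J₃((W·∇)W + (W'·∇)W') = 0` for an `n`-fold wave `W` with
companion `W' = n⁻¹J₃W`, `n ≠ 0` (twice the letter of `Qlwave.meanStress n W`). [folklore] -/
theorem zonal_convect_self_add_conj (hW : ContDiff ℝ ∞ W) (hn : n ≠ 0)
    (hwave : ∀ y, angGen 2 (angGen 2 W) y = -(((n : ℝ) ^ 2) • W y))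
    (hW' : W' = fun y => ((n : ℝ)⁻¹) • angGen 2 W y) :
    ∀ y, angGen 2 (fun x => convect W W x + convect W' W' x) y = 0 := by
  have hWs' : ContDiff ℝ ∞ W' := contDiff_conj hW hW'
  have hWd : Differentiable ℝ W := hW.differentiable (by simp)
  have hWd' : Differentiable ℝ W' := hWs'.differentiable (by simp)
  have hc1 : Differentiable ℝ (convect W W) := (contDiff_convect hW hW).differentiable (by simp)
  have hc2 : Differentiable ℝ (convect W' W') :=
    (contDiff_convect hWs' hWs').differentiable (by simp)
  have eJW : angGen 2 W = fun y => (n : ℝ) • W' y := funext fun y => (smul_conj hn hW' y).symm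
  have eJW' : angGen 2 W' = fun y => (-(n : ℝ)) • W y :=
    funext fun y => by rw [angGen_conj hW hn hwave hW' y, neg_smul]
  intro y
  rw [show (fun x => convect W W x + convect W' W' x) = convect W W + convect W' W' from rfl,
    angGen_add hc1 hc2, Pi.add_apply, angGen_convect hW hW 2 y, angGen_convect hWs' hWs' 2 y, eJW,
    eJW',
    convect_smul_left, convect_smul_right W hWd', convect_smul_left, convect_smul_right W' hWd]
  simp only [neg_smul]
  abel

/-- The letter of `Qlwave.meanStress n W` is zonal: `J₃(½((W·∇)W + (W'·∇)W')) = 0`. [folklore] -/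
theorem zonal_meanStress (hW : ContDiff ℝ ∞ W) (hn : n ≠ 0)
    (hwave : ∀ y, angGen 2 (angGen 2 W) y = -(((n : ℝ) ^ 2) • W y))
    (hW' : W' = fun y => ((n : ℝ)⁻¹) • angGen 2 W y) :
    ∀ y, angGen 2 (fun x => (1 / 2 : ℝ) • (convect W W x + convect W' W' x)) y = 0 := by
  have hWs' : ContDiff ℝ ∞ W' := contDiff_conj hW hW'
  have hM : Differentiable ℝ (fun x => convect W W x + convect W' W' x) :=
    ((contDiff_convect hW hW).add (contDiff_convect hWs' hWs')).differentiable (by simp)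
  intro y
  rw [show (fun x => (1 / 2 : ℝ) • (convect W W x + convect W' W' x)) =
      (1 / 2 : ℝ) • (fun x => convect W W x + convect W' W' x) from rfl,
    angGen_smul hM, Pi.smul_apply, zonal_convect_self_add_conj hW hn hwave hW' y, smul_zero]

/-- `J₃((W·∇)W − (W'·∇)W') = 2n((W'·∇)W + (W·∇)W')`. [folklore] -/
theorem angGen_convect_self_sub_conj (hW : ContDiff ℝ ∞ W) (hn : n ≠ 0)
    (hwave : ∀ y, angGen 2 (angGen 2 W) y = -(((n : ℝ) ^ 2) • W y))
    (hW' : W' = fun y => ((n : ℝ)⁻¹) • angGen 2 W y) (y : EuclideanSpace ℝ (Fin 3)) :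
    angGen 2 (fun x => convect W W x - convect W' W' x) y =
      (2 * (n : ℝ)) • (convect W' W y + convect W W' y) := by
  have hWs' : ContDiff ℝ ∞ W' := contDiff_conj hW hW'
  have hWd : Differentiable ℝ W := hW.differentiable (by simp)
  have hWd' : Differentiable ℝ W' := hWs'.differentiable (by simp)
  have hc1 : Differentiable ℝ (convect W W) := (contDiff_convect hW hW).differentiable (by simp)
  have hc2 : Differentiable ℝ (convect W' W') :=
    (contDiff_convect hWs' hWs').differentiable (by simp)
  have eJW : angGen 2 W = fun y => (n : ℝ) • W' y := funext fun y => (smul_conj hn hW' y).symm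
  have eJW' : angGen 2 W' = fun y => (-(n : ℝ)) • W y :=
    funext fun y => by rw [angGen_conj hW hn hwave hW' y, neg_smul]
  have hsub := congrFun (angGen_sub_smul hc1 hc2 1 2) y
  simp only [one_smul] at hsub
  rw [hsub, angGen_convect hW hW 2 y, angGen_convect hWs' hWs' 2 y, eJW, eJW',
    convect_smul_left, convect_smul_right W hWd', convect_smul_left, convect_smul_right W' hWd]
  simp only [neg_smul, mul_smul, two_smul, smul_add]
  abel

/-- `J₃((W'·∇)W + (W·∇)W') = −2n((W·∇)W − (W'·∇)W')`. [folklore] -/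
theorem angGen_convect_conj_add (hW : ContDiff ℝ ∞ W) (hn : n ≠ 0)
    (hwave : ∀ y, angGen 2 (angGen 2 W) y = -(((n : ℝ) ^ 2) • W y))
    (hW' : W' = fun y => ((n : ℝ)⁻¹) • angGen 2 W y) (y : EuclideanSpace ℝ (Fin 3)) :
    angGen 2 (fun x => convect W' W x + convect W W' x) y =
      -((2 * (n : ℝ)) • (convect W W y - convect W' W' y)) := by
  have hWs' : ContDiff ℝ ∞ W' := contDiff_conj hW hW'
  have hWd : Differentiable ℝ W := hW.differentiable (by simp)
  have hWd' : Differentiable ℝ W' := hWs'.differentiable (by simp)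
  have hc1 : Differentiable ℝ (convect W' W) := (contDiff_convect hWs' hW).differentiable (by simp)
  have hc2 : Differentiable ℝ (convect W W') := (contDiff_convect hW hWs').differentiable (by simp)
  have eJW : angGen 2 W = fun y => (n : ℝ) • W' y := funext fun y => (smul_conj hn hW' y).symm
  have eJW' : angGen 2 W' = fun y => (-(n : ℝ)) • W y :=
    funext fun y => by rw [angGen_conj hW hn hwave hW' y, neg_smul]
  rw [show (fun x => convect W' W x + convect W W' x) = convect W' W + convect W W' from rfl,
    angGen_add hc1 hc2, Pi.add_apply, angGen_convect hWs' hW 2 y, angGen_convect hW hWs' 2 y, eJW,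
    eJW',
    convect_smul_left, convect_smul_right W' hWd', convect_smul_left, convect_smul_right W hWd]
  simp only [neg_smul, mul_smul, two_smul, smul_sub]
  abel

/-- **The wave–wave fluctuation is a `2n`-fold wave**: for an `n`-fold wave `W` (`n ≠ 0`) with
companion `W'`, `F = (W·∇)W − (W'·∇)W'` satisfies `J₃(J₃F) = −(2n)²F`. [folklore] -/
theorem wave_convect_self_sub_conj (hW : ContDiff ℝ ∞ W) (hn : n ≠ 0)
    (hwave : ∀ y, angGen 2 (angGen 2 W) y = -(((n : ℝ) ^ 2) • W y))
    (hW' : W' = fun y => ((n : ℝ)⁻¹) • angGen 2 W y) :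
    ∀ y, angGen 2 (angGen 2 (fun x => convect W W x - convect W' W' x)) y =
      -(((2 * n : ℕ) : ℝ) ^ 2 • (convect W W y - convect W' W' y)) := by
  have hWs' : ContDiff ℝ ∞ W' := contDiff_conj hW hW'
  have hG : Differentiable ℝ (fun x => convect W' W x + convect W W' x) :=
    ((contDiff_convect hWs' hW).add (contDiff_convect hW hWs')).differentiable (by simp)
  have h1 : angGen 2 (fun x => convect W W x - convect W' W' x) =
      (2 * (n : ℝ)) • (fun x => convect W' W x + convect W W' x) :=
    funext fun y => by rw [angGen_convect_self_sub_conj hW hn hwave hW' y, Pi.smul_apply]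
  intro y
  rw [h1, angGen_smul hG, Pi.smul_apply, angGen_convect_conj_add hW hn hwave hW' y, smul_neg,
    smul_smul]
  congr 2
  push_cast
  ring

/-- The letter of `Qlwave.waveFluctuation n W` (`(W·∇)W − ½((W·∇)W + (W'·∇)W')`) is a `2n`-fold
wave. [folklore] -/
theorem wave_waveFluctuation (hW : ContDiff ℝ ∞ W) (hn : n ≠ 0)
    (hwave : ∀ y, angGen 2 (angGen 2 W) y = -(((n : ℝ) ^ 2) • W y))
    (hW' : W' = fun y => ((n : ℝ)⁻¹) • angGen 2 W y) :
    ∀ y, angGen 2 (angGen 2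
        (fun x => convect W W x - (1 / 2 : ℝ) • (convect W W x + convect W' W' x))) y =
      -(((2 * n : ℕ) : ℝ) ^ 2 •
        (convect W W y - (1 / 2 : ℝ) • (convect W W y + convect W' W' y))) := by
  have hWs' : ContDiff ℝ ∞ W' := contDiff_conj hW hW'
  have hF : ContDiff ℝ ∞ (fun x => convect W W x - convect W' W' x) :=
    (contDiff_convect hW hW).sub (contDiff_convect hWs' hWs')
  have hlit : (fun x => convect W W x - (1 / 2 : ℝ) • (convect W W x + convect W' W' x)) =
      (1 / 2 : ℝ) • (fun x => convect W W x - convect W' W' x) := by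
    funext x
    simp only [Pi.smul_apply, smul_add, smul_sub]
    module
  intro y
  have hy : convect W W y - (1 / 2 : ℝ) • (convect W W y + convect W' W' y) =
      (1 / 2 : ℝ) • (convect W W y - convect W' W' y) := by
    simp only [smul_add, smul_sub]
    module
  rw [hy, hlit, angGen_smul (hF.differentiable (by simp)),
    angGen_smul ((contDiff_angGen hF 2).differentiable (by simp)), Pi.smul_apply,
    wave_convect_self_sub_conj hW hn hwave hW' y, smul_neg]
  congr 1
  exact smul_comm _ _ _

end Azimuthal

end Summit.NavierStokesRegularity.AngularGalerkinLadderAzimuthalLeibniz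

end
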